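import Mathlib
import Summits.NavierStokesRegularity.NavierStokesRegularity.Theses.MarginalTypeI
import HarnessLib

/-!
# Route MarginalTypeI — `Assembly` PROVED (stmt-NavierStokesRegularity-11303; pure logic)

`MarginalBlowupTypeI → NoTypeIAncient → CriticalViscosityExists → LocalTypeIExtraction →
ABForwardMeasurable → KatoToClay → NavierStokesRegularity`: exactly the route's deciding theorem
`closes`, curried (a global Kato solution gives Clay (A) by `KatoToClay`; otherwise the critical
viscosity carries a marginal Type-I blow-up whose extracted local Type-I singularity yields, by the
Albritton–Barker forward map, a Type-I ancient solution excluded by `NoTypeIAncient`).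

HONEST FRAMING: pure logic; the route's cruxes remain OPEN hypotheses; nothing here bears on the
regularity question. Lands `--workitem stmt-NavierStokesRegularity-11303` (typer seat g19 of cell
pub-ns-dss, idle-row item).
-/

namespace Summit.NavierStokesRegularity.NavierStokesRegularity.Theorems

set_option linter.dupNamespace false

/-- **`Assembly` of route MarginalTypeI (stmt-NavierStokesRegularity-11303)**, the curried deciding
theorem (pure logic). [this file] -/
theorem marginalTypeI_assembly_proof : Theses.MarginalTypeI.Assembly := by
  intro h₁ h₃ hcv hext hab hclay ν hν u₀ hsm hdiv hdec
  by_cases hK : Literature.Analysis.FluidPDE.HasGlobalKatoSolution ν u₀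
  · exact hclay ν hν u₀ hsm hdiv hdec hK
  · exfalso
    obtain ⟨νc, hle, hnot, hglob⟩ := hcv ν hν u₀ hsm hdiv hdec hK
    have hνc : 0 < νc := lt_of_lt_of_le hν hle
    exact h₃ (hab (hext νc hνc u₀ hsm hdiv hdec hnot (h₁ νc hνc u₀ hsm hdiv hdec hglob hnot)))

end Summit.NavierStokesRegularity.NavierStokesRegularity.Theorems
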